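import Mathlib.RepresentationTheory.Homological.GroupCohomology.LowDegree
import Mathlib.LinearAlgebra.LinearIndependent.Lemmas
import Literature.AlgebraicGeometry.HodgeTheory.LocallyTrivialExtensionClasses

/-!
# Route LinearSystemTorelli — crux `LocalTubeSpan`: Schnell's detection by a transvection frame

Helper file (`--supports stmt-HodgeConjecture-2490`, line `Sketch`, stub `SchnellFrame` — the
hardest stub, taken by the line lead). The formal core of C. Schnell, *Primitive cohomology and
the tube mapping*, Math. Z. 268 (2010) (= arXiv:0711.3927), §7 Proposition 12 (and §6 Prop. 8):
the injectivity of Schnell's *third map*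
`H¹(G, V) → ∏_{g ∈ G} V/(g - 1)V` ("every non-zero class is detected by a single element"),
with the vanishing-lattice hypothesis replaced by exactly what the printed proof USES, namely a
**detecting frame**:

* `G` is generated by a set `s` of *rank-one elements fixing their direction*: for `t ∈ s` there is
  `e_t` with `(t - 1)V ⊆ k·e_t` and `t·e_t = e_t` (Picard–Lefschetz transvections
  `T_e(v) = v - ⟨v, e⟩e` of a skew form);
* there are finitely many elements `u_0, …, u_{r-1} ∈ G`, rank-one along LINEARLY INDEPENDENT
  vectors `δ_0, …, δ_{r-1}` (`(u_i - 1)V ⊆ k·δ_i`), such that the subgroup `Γ' = ⟨u_i⟩` contains a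
  positive power of every generator `t ∈ s`.

In [Schnell2010] the frame is supplied by Lemma 11 (from W. Janssen's Theorem 2.5 on
skew-symmetric vanishing lattices: `r = rk V` independent vanishing cycles whose transvections
generate a finite-index subgroup — a finite-index subgroup contains a positive power of every
element); the present theorem is the remaining, elementary half of the proof (adjust the cocycle
to vanish at `u_{r-1}⋯u_0`, peel off the `δ_i`-components by linear independence — Lemma 9 —,
conclude `φ|Γ' = 0`, then `φ(t^m) = m·φ(t) = 0` kills every generator in characteristic zero).
For the crux this is the common target `P(V; δ)` / `RadicalProp12` of the crux idea cards
`pencil-configuration-janssen` and `central-meridian-inflation`: LocalTubeSpan at `s₀` follows from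
a detecting frame inside the linear local monodromy group `Γ_loc = ⟨T_δ : δ ∈ Δ_loc⟩`.

Everything is over a field `k` of characteristic zero and an arbitrary group `G`; no named facts.
-/

-- `Summit.HodgeConjecture.HodgeConjecture.Theorems` is the mandated namespace (single-conjunct summit:
-- Sub = Summit), which `linter.dupNamespace` flags on every declaration; the lakefile turns the
-- linter off tree-wide (weak option), restated here so stand-alone elaboration is warning-free too.
set_option linter.dupNamespace false

noncomputable section

open CategoryTheory groupCohomology
open Literature.AlgebraicGeometry.HodgeTheory

namespace Summit.HodgeConjecture.HodgeConjecture.Theorems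

universe u

section General

variable {k G : Type u} [CommRing k] [Group G] (A : Rep k G)

/-- A `1`-cocycle vanishing on a set vanishes on the subgroup it generates (its zero set is a
subgroup: `φ(gh) = g·φ(h) + φ(g)`, `g·φ(g⁻¹) = -φ(g)`). [folklore] -/
theorem localTubeSpan_cocycles₁_apply_eq_zero_of_mem_closure (φ : cocycles₁ A) (s : Set G)
    (hs : ∀ g ∈ s, (φ : G → A.V) g = 0) {g : G} (hg : g ∈ Subgroup.closure s) :
    (φ : G → A.V) g = 0 := by
  induction hg using Subgroup.closure_induction with
  | mem g hg => exact hs g hg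
  | one => exact cocycles₁_map_one φ
  | mul g h _ _ ihg ihh => rw [(mem_cocycles₁_iff φ).1 φ.2 g h, ihg, ihh, map_zero, add_zero]
  | inv g _ ih =>
      have h1 := cocycles₁_map_inv φ g
      rw [ih, neg_zero] at h1
      have h2 := congrArg (A.ρ g⁻¹) h1
      rwa [Representation.inv_self_apply, map_zero] at h2

/-- `φ(t^m) = m·φ(t)` for a `1`-cocycle `φ` and an element `t` fixing the vector `φ(t)`
(e.g. a transvection `T_e`, which fixes its direction `e ∋ φ(T_e)`).
[cite: Schnell2010, §7 (proof of Prop. 12, last paragraph)] -/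
theorem localTubeSpan_cocycles₁_apply_pow_of_fix (φ : cocycles₁ A) (t : G)
    (ht : A.ρ t ((φ : G → A.V) t) = (φ : G → A.V) t) (m : ℕ) :
    (φ : G → A.V) (t ^ m) = (m : k) • (φ : G → A.V) t := by
  induction m with
  | zero => simp
  | succ m ih =>
      rw [pow_succ', (mem_cocycles₁_iff φ).1 φ.2 t (t ^ m), ih, map_smul, ht, Nat.cast_succ,
        add_smul, one_smul]

/-- Undetectedness of a cocycle (`φ g ∈ (g - 1)A` for all `g`) is insensitive to coboundaries.
[folklore] -/
theorem localTubeSpan_undetected_sub_d₀₁ (φ : cocycles₁ A)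
    (hφ : ∀ g : G, (φ : G → A.V) g ∈ subOneRange A g) (v : A.V) (g : G) :
    ((φ - ⟨d₀₁ A v, d₀₁_apply_mem_cocycles₁ v⟩ : cocycles₁ A) : G → A.V) g ∈ subOneRange A g := by
  have e : ((φ - ⟨d₀₁ A v, d₀₁_apply_mem_cocycles₁ v⟩ : cocycles₁ A) : G → A.V) g =
      (φ : G → A.V) g - (A.ρ g v - v) := by
    change (φ : G → A.V) g - d₀₁ A v g = _
    rw [d₀₁_hom_apply]
  rw [e]
  exact (subOneRange A g).sub_mem (hφ g) ⟨v, rfl⟩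

end General

section Frame

variable {k G : Type u} [Field k] [CharZero k] [Group G] (A : Rep k G)

/-- **Schnell's detection theorem, frame form** ([Schnell2010] Prop. 12 / Prop. 8 with the
vanishing-lattice input isolated). Let `G` act on the `k`-vector space `A` (`char k = 0`) and be
generated by a set `s` of rank-one elements fixing their direction (`(t - 1)A ⊆ k·e_t`,
`t·e_t = e_t`). Suppose there are elements `u_0, …, u_{r-1}` of `G`, rank-one along linearly
independent vectors `δ_i` (`(u_i - 1)A ⊆ k·δ_i`), generating a subgroup that contains a positive
power of every `t ∈ s`. Then Schnell's third map `H¹(G, A) → ∏_{g ∈ G} A/(g - 1)A` is injective: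
a class undetected by every single element of `G` is zero.
[cite: Schnell2010, §7 Prop. 12 (proof) and §6 Lemma 9] -/
theorem localTubeSpan_injective_evalCoinv_of_frame (s : Set G) (hs : Subgroup.closure s = ⊤)
    (e : G → A.V) (hse : ∀ t ∈ s, subOneRange A t ≤ k ∙ e t)
    (hfix : ∀ t ∈ s, A.ρ t (e t) = e t) {r : ℕ} (u : Fin r → G) (δ : Fin r → A.V)
    (hδ : LinearIndependent k δ) (hu : ∀ i, subOneRange A (u i) ≤ k ∙ δ i)
    (hvirt : ∀ t ∈ s, ∃ m : ℕ, 0 < m ∧ t ^ m ∈ Subgroup.closure (Set.range u)) :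
    Function.Injective (evalCoinv A) := by
  refine (injective_iff_map_eq_zero _).2 fun ξ hξ => ?_
  induction ξ using H1_induction_on with
  | h φ₀ =>
  -- `φ₀` is undetected by every element
  have hund₀ : ∀ g : G, (φ₀ : G → A.V) g ∈ subOneRange A g := fun g => by
    have := congr_fun hξ g
    rwa [evalCoinv_H1π, Pi.zero_apply, Submodule.mkQ_apply, Submodule.Quotient.mk_eq_zero]
      at this
  -- the ordered products `P n = u_{n-1} ⋯ u_0` (with `u_i = 1` beyond `r`)
  let ub : ℕ → G := fun i => if h : i < r then u ⟨i, h⟩ else 1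
  let P : ℕ → G := fun n => Nat.rec (motive := fun _ => G) 1 (fun i g => ub i * g) n
  have hP0 : P 0 = 1 := rfl
  have hPsucc : ∀ n, P (n + 1) = ub n * P n := fun n => rfl
  have hub : ∀ i : Fin r, ub i = u i := fun i => by
    simp only [ub, dif_pos i.2]
  -- Step 1: adjust by a coboundary so that the cocycle vanishes at `P r`
  obtain ⟨v, hv⟩ := hund₀ (P r)
  set φ : cocycles₁ A := φ₀ - ⟨d₀₁ A v, d₀₁_apply_mem_cocycles₁ v⟩ with hφdef
  have hφapply : ∀ g, (φ : G → A.V) g = (φ₀ : G → A.V) g - (A.ρ g v - v) := fun g => by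
    rw [hφdef]
    change (φ₀ : G → A.V) g - d₀₁ A v g = _
    rw [d₀₁_hom_apply]
  have hund : ∀ g : G, (φ : G → A.V) g ∈ subOneRange A g :=
    localTubeSpan_undetected_sub_d₀₁ A φ₀ hund₀ v
  have hφPr : (φ : G → A.V) (P r) = 0 := by
    rw [hφapply, ← hv, LinearMap.sub_apply, LinearMap.id_apply, sub_self]
  -- it suffices to show that the adjusted cocycle vanishes identically
  suffices hall : ∀ g, (φ : G → A.V) g = 0 by
    rw [H1π_eq_zero_iff, mem_coboundaries₁_iff_exists]
    exact ⟨v, fun g => by have := hall g; rw [hφapply, sub_eq_zero] at this; exact this.symm⟩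
  -- the cocycle identity along the products
  have hcoc : ∀ n, (φ : G → A.V) (P (n + 1)) = A.ρ (ub n) ((φ : G → A.V) (P n)) +
      (φ : G → A.V) (ub n) := fun n => by
    rw [hPsucc, (mem_cocycles₁_iff φ).1 φ.2]
  -- Step 2 (Lemma 9): increments lie on the lines `k·δ_n`, partial values in the spans
  have hstep : ∀ (n : ℕ) (hn : n < r),
      (φ : G → A.V) (P (n + 1)) - (φ : G → A.V) (P n) ∈ k ∙ δ ⟨n, hn⟩ := fun n hn => by
    have e1 : (φ : G → A.V) (P (n + 1)) - (φ : G → A.V) (P n) =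
        (A.ρ (u ⟨n, hn⟩) ((φ : G → A.V) (P n)) - (φ : G → A.V) (P n)) +
          (φ : G → A.V) (u ⟨n, hn⟩) := by
      rw [hcoc n, ← hub ⟨n, hn⟩]
      abel
    rw [e1]
    exact Submodule.add_mem _ (hu ⟨n, hn⟩ ⟨_, rfl⟩) (hu ⟨n, hn⟩ (hund _))
  have hspan : ∀ n, n ≤ r →
      (φ : G → A.V) (P n) ∈ Submodule.span k (δ '' {i : Fin r | (i : ℕ) < n}) := by
    intro n
    induction n with
    | zero =>
        intro _
        rw [hP0, cocycles₁_map_one]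
        exact Submodule.zero_mem _
    | succ n ih =>
        intro hn
        have hn' : n < r := Nat.lt_of_succ_le hn
        have e1 : (φ : G → A.V) (P (n + 1)) =
            (φ : G → A.V) (P n) + ((φ : G → A.V) (P (n + 1)) - (φ : G → A.V) (P n)) := by abel
        rw [e1]
        refine Submodule.add_mem _ (Submodule.span_mono (Set.image_mono ?_) (ih hn'.le))
          (Submodule.span_mono ?_ (hstep n hn'))
        · intro i hi
          exact Nat.lt_succ_of_lt hi
        · rintro _ ⟨rfl⟩
          exact ⟨⟨n, hn'⟩, Nat.lt_succ_self n, rfl⟩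
  -- Step 3: peel off, using linear independence of the `δ_i`
  have hdown : ∀ (n : ℕ) (hn : n < r), (φ : G → A.V) (P (n + 1)) = 0 →
      (φ : G → A.V) (P n) = 0 := fun n hn h0 => by
    have hdisj : Disjoint (Submodule.span k (δ '' {i : Fin r | (i : ℕ) < n}))
        (Submodule.span k (δ '' {⟨n, hn⟩})) := by
      refine hδ.disjoint_span_image (Set.disjoint_left.2 ?_)
      rintro i hi rfl
      exact lt_irrefl n hi
    have hy : (φ : G → A.V) (P n) ∈ Submodule.span k (δ '' {i : Fin r | (i : ℕ) < n}) :=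
      hspan n hn.le
    have hx : -((φ : G → A.V) (P (n + 1)) - (φ : G → A.V) (P n)) ∈
        Submodule.span k (δ '' {⟨n, hn⟩}) := by
      rw [Set.image_singleton]
      exact Submodule.neg_mem _ (hstep n hn)
    rw [h0, zero_sub, neg_neg] at hx
    exact (Submodule.disjoint_def.1 hdisj) _ hy hx
  have hzeroP : ∀ m, m ≤ r → (φ : G → A.V) (P (r - m)) = 0 := by
    intro m
    induction m with
    | zero => intro _; simpa using hφPr
    | succ m ih =>
        intro hm
        have e1 : r - m = (r - (m + 1)) + 1 := by omega
        exact hdown _ (by omega) (e1 ▸ ih (Nat.le_of_succ_le hm))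
  have hzeroP' : ∀ n, n ≤ r → (φ : G → A.V) (P n) = 0 := fun n hn => by
    have := hzeroP (r - n) (Nat.sub_le r n)
    rwa [Nat.sub_sub_self hn] at this
  -- Step 4: the cocycle vanishes on the frame, hence on `Γ' = ⟨u_i⟩`
  have hu0 : ∀ i : Fin r, (φ : G → A.V) (u i) = 0 := fun i => by
    have := hcoc i
    rw [hzeroP' (i + 1) i.2, hzeroP' i i.2.le, map_zero, zero_add, hub] at this
    exact this.symm
  have hΓ' : ∀ g ∈ Subgroup.closure (Set.range u), (φ : G → A.V) g = 0 := fun g hg =>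
    localTubeSpan_cocycles₁_apply_eq_zero_of_mem_closure A φ (Set.range u)
      (by rintro _ ⟨i, rfl⟩; exact hu0 i) hg
  -- Step 5: generators — `φ(t) = a·e_t`, `φ(t^m) = m·φ(t) ∈ φ(Γ') = 0`, char 0
  have hgen : ∀ t ∈ s, (φ : G → A.V) t = 0 := fun t ht => by
    obtain ⟨a, ha⟩ := Submodule.mem_span_singleton.1 (hse t ht (hund t))
    have hfixφ : A.ρ t ((φ : G → A.V) t) = (φ : G → A.V) t := by
      rw [← ha, map_smul, hfix t ht]
    obtain ⟨m, hm, hmem⟩ := hvirt t ht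
    have h1 := localTubeSpan_cocycles₁_apply_pow_of_fix A φ t hfixφ m
    rw [hΓ' _ hmem] at h1
    have hm' : (m : k) ≠ 0 := Nat.cast_ne_zero.2 (Nat.pos_iff_ne_zero.1 hm)
    exact ((smul_eq_zero.1 h1.symm).resolve_left hm')
  -- Step 6: everything
  intro g
  exact localTubeSpan_cocycles₁_apply_eq_zero_of_mem_closure A φ s hgen
    (by rw [hs]; exact Subgroup.mem_top g)

end Frame

end Summit.HodgeConjecture.HodgeConjecture.Theorems

end
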